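import Mathlib
import Summits.CriticalPhenomena.CardyFormulaZ2.Theorems.CardySelfRefinementDefs
import Summits.CriticalPhenomena.CardyFormulaZ2.Theorems.CardySelfRefinementGradientComparabilityStubCornerWindowsDefect
import Summits.CriticalPhenomena.CardyFormulaZ2.Theorems.CardySelfRefinementGradientComparabilityStubNonAxialShareBulkReroute
import Summits.CriticalPhenomena.CardyFormulaZ2.Theorems.CardySelfRefinementGradientComparabilityStubPivotalUniformlySmall
import Literature.Probability.LatticeModels.MedialPerturbation
import HarnessLib

/-!
# Crux `GradientComparability` (stmt-CriticalPhenomena-10269), line `monotone-product-coordinates` —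
# stub `stub_cornerLocalSlope` (LOC), penalty bound (A″₂), part 1: a pendant edge is never pivotal,
# and a proper pattern of a far `k = 2` bundle crosses only through an OPEN interior edge at its
# midpoint

Route `CardySelfRefinement`, sub-problem `CriticalPhenomena/CardyFormulaZ2`; vocabulary from
`CardySelfRefinementDefs` (`ax tb cfg M Aloc window edgeOf dirVec`), the canonical enumeration of a
bundle from `…StubCornerWindowsDefect` (`bundle_param_canonical`), closure-semantics rerouting from
the bulk toolkit `…StubNonAxialShareBulkReroute` (`crossing_reroute`, `ball_subset_interior_or_disjoint`,
`exists_vertex_of_mem_inter`), the bridge `mem_configOf_iff_exists_isCrossing_openEdgeUnion`, and `fin_two_cases_of_ne`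
(`MedialPerturbation`).

## Mathematics

The exact corner dictionary (`Drho_eq_sum_half_pivotal_sub_defect`, any `k`, any `(ρ, c)`) reads
`∂ρP = Σ_B ( ½ M(B set-pivotal) − 2^{-k} Σ_{J ⊆ [k]} M(A_B^J ∖ A_B^∅) )`, `A_B^J = {(ω ∖ B) ∪ J ∈ Aloc}`;
its only negative terms are the DEFECTS `M(A_B^J ∖ A_B^∅)` of the proper patterns `J ⊊ [k]`.  The
local corner slope bound (LOC) needs them to carry a factor `c` in the bulk (report §3, (A″_k)).
This file proves the deterministic core for `k = 2`:

* `crossing_sdiff_pendant`, `sdiff_mem_Aloc_of_pendant` — **a pendant edge is never pivotal**: if no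
  other open lattice edge of `ω` ends at `v` and the drawn `v` is `r`-far (`r ≥ 2η`) from every quad
  side, then `ω ∪ {av} ∈ Aloc → ω ∖ {av} ∈ Aloc`.  In the Schramm–Smirnov closure semantics: the
  drawings of `ω ∖ {av}` and of `{av}` meet at most at the drawn `a`, so a crossing continuum is
  rerouted through that point (`crossing_reroute` with a one-point patch), or the segment misses the
  quad.
* `defect_two_subset_open` (registered) — for `k = 2`, the bundle of `(t, d)` is `{a, v} ∪ {v, b}`
  with midpoint `v = 2t + e_d`, and the other two lattice edges at `v` are the interior edges
  `g₊ = edgeOf (v, d')`, `g₋ = edgeOf (v − e_{d'}, d')` (`d' ≠ d`, non-axial: `v_d` is odd).  If `v`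
  is `r`-far from the sides, `J ⊊ [2]` and `ω ∈ A^J ∖ A^∅`, then `g₊ ∈ ω` or `g₋ ∈ ω`: otherwise
  the single pattern edge is pendant at `v`.

Part 2 (`…StubSlopeBoundsCornerPenalty`) turns this into the bound
`M(A^J ∖ A^∅) ≤ c · (2/(1−c) · M(B set-pivotal) + 8 · Σ_{g = g±} M(g pivotal))`.
-/

noncomputable section

namespace Summit.CriticalPhenomena.CardyFormulaZ2.Theorems.CardySelfRefinement

open scoped Topology
open Filter Set MeasureTheory
open Literature.Probability.LatticeModels Literature.Probability.Percolation
open Literature.Probability.Percolation.QuadCrossing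
open Summit.CriticalPhenomena.CardyFormulaZ2.Theses.CardySelfRefinement

/-! ## A pendant edge far from the sides is never pivotal (closure semantics) -/

/-- **Removing a pendant edge keeps a crossing.**  Let `{a, v}` be a lattice edge such that no
other open edge of `ω` ends at `v`, and let the `r`-ball around the drawn `v` (`r > δ`) meet no
side of the quad `Q`.  Then every crossing of `Q` inside the drawing of `ω ∪ {av}` yields one
inside the drawing of `ω ∖ {av}`: the drawings of `ω ∖ {av}` and of `{av}` meet at most at the
drawn `a`, so the crossing is rerouted through that single point (`crossing_reroute`), or the
segment misses `[Q]` altogether. -/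
theorem crossing_sdiff_pendant {D : Set ℂ} {δ : ℝ} (hδ : 0 < δ) (Q : Quad D)
    {ω : BondConfig (Site 2)} {a v : Site 2} (hav : (zdGraph 2).Adj a v)
    (hv : ∀ y, (zdGraph 2).Adj v y → s(v, y) ∈ ω → y = a) {r : ℝ} (hδr : δ < r)
    (hfar : ∀ j : Fin 4, ∀ p ∈ Q.side j, r ≤ dist (meshPoint δ v) p)
    (hcr : ∃ K, Q.IsCrossing K ∧ K ⊆ openEdgeUnion δ (insert s(a, v) ω)) :
    ∃ K, Q.IsCrossing K ∧ K ⊆ openEdgeUnion δ (ω \ {s(a, v)}) := by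
  have hsub : insert s(a, v) ω ⊆ ω \ {s(a, v)} ∪ {s(a, v)} := by
    intro e he
    by_cases h : e = s(a, v)
    · exact Or.inr h
    · exact Or.inl ⟨(Set.mem_insert_iff.1 he).resolve_left h, h⟩
  have hseg_ball : segment ℝ (meshPoint δ a) (meshPoint δ v) ⊆ Metric.ball (meshPoint δ v) r := by
    intro z hz
    rw [Metric.mem_ball, dist_comm]
    rw [segment_symm] at hz
    exact (dist_meshPoint_le_of_mem_segment hδ hav.symm hz).trans_lt hδr
  have hRball : openEdgeUnion δ {s(a, v)} ⊆ Metric.ball (meshPoint δ v) r :=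
    (openEdgeUnion_singleton_subset δ a v).trans hseg_ball
  rcases ball_subset_interior_or_disjoint Q hfar with hin | hout
  · refine crossing_reroute hδ Q hsub
      (P := {z | z = meshPoint δ a ∧ z ∈ openEdgeUnion δ (ω \ {s(a, v)})}) ?_ ?_ ?_ ?_ ?_ ?_ hcr
    · exact (Set.subsingleton_of_forall_eq (meshPoint δ a) fun z hz => hz.1).isCompact
    · exact (Set.subsingleton_of_forall_eq (meshPoint δ a) fun z hz => hz.1).isPreconnected
    · rintro z ⟨rfl, -⟩
      exact interior_subset (hin (hseg_ball (left_mem_segment ℝ _ _)))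
    · exact fun z hz => hz.2
    · intro z hzO hzR
      obtain ⟨x, rfl, ⟨y, -, hxy⟩, ⟨y', hxy', hy'⟩⟩ :=
        exists_vertex_of_mem_inter hδ (S := {s(a, v)}) (T := ω \ {s(a, v)})
          (fun e he hT => hT.2 he) hzR hzO
      rcases Sym2.eq_iff.1 (Set.mem_singleton_iff.1 hxy) with ⟨rfl, -⟩ | ⟨rfl, -⟩
      · exact ⟨rfl, hzO⟩
      · obtain rfl := hv y' hxy' hy'.1
        exact absurd Sym2.eq_swap hy'.2
    · intro z hz
      have hzi : z ∈ interior Q.carrier := hin (hRball hz)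
      exact ⟨notMem_side_of_mem_interior Q hzi 0, notMem_side_of_mem_interior Q hzi 2⟩
  · exact crossing_of_subset_union_of_disjoint δ Q hsub (fun z hz => hout z (hRball hz)) hcr

/-- **A pendant edge far from the quad sides is never pivotal for `Aloc`.**  If no open lattice
edge of `ω` other than `{a, v}` ends at `v`, and the drawn `v` is at distance `≥ r ≥ 2η` from every
side of every quad of the family, then `ω ∪ {av} ∈ Aloc m F η → ω ∖ {av} ∈ Aloc m F η`. -/
theorem sdiff_mem_Aloc_of_pendant (m : ℕ) (F : Fin m → Quad (Set.univ : Set ℂ)) {η r : ℝ}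
    (hη : 0 < η) (hηr : 2 * η ≤ r) {ω : BondConfig (Site 2)} {a v : Site 2}
    (hav : (zdGraph 2).Adj a v) (hv : ∀ y, (zdGraph 2).Adj v y → s(v, y) ∈ ω → y = a)
    (hfar : ∀ (i : Fin m) (j : Fin 4), ∀ p ∈ (F i).side j,
      r ≤ dist ((η : ℂ) * squareLatticeEmbedding.z v) p)
    (hin : insert s(a, v) ω ∈ Aloc m F η) : ω \ {s(a, v)} ∈ Aloc m F η := by
  set W : Set (Sym2 (Site 2)) := window m F η with hW_def
  have hW : W ⊆ (zdGraph 2).edgeSet := Set.iUnion_subset fun i => Set.inter_subset_right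
  set dd : ℝ := η * Real.sqrt 2 with hdd_def
  have hdd : 0 < dd := by positivity
  have hsqrt : Real.sqrt 2 < 3 / 2 := (Real.sqrt_lt' (by norm_num)).2 (by norm_num)
  have hddr : dd < r := by rw [hdd_def]; nlinarith
  have hz : (η : ℂ) * squareLatticeEmbedding.z v = meshPoint dd v := by
    simp only [squareLatticeEmbedding, meshPoint, Complex.ofReal_mul, mul_assoc, hdd_def]
  have he : s(a, v) ∈ (zdGraph 2).edgeSet := (SimpleGraph.mem_edgeSet _).2 hav
  have hσE : insert s(a, v) (ω ∩ W) ⊆ (zdGraph 2).edgeSet :=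
    Set.insert_subset he (Set.inter_subset_right.trans hW)
  have h1 : insert s(a, v) ω ∩ W ⊆ insert s(a, v) (ω ∩ W) := by
    rintro e ⟨he, heW⟩
    rcases Set.mem_insert_iff.1 he with rfl | heω
    · exact Set.mem_insert _ _
    · exact Set.mem_insert_of_mem _ ⟨heω, heW⟩
  have h2 : (ω ∩ W) \ {s(a, v)} ⊆ ω \ {s(a, v)} ∩ W := by
    rintro e ⟨⟨heω, heW⟩, hne⟩
    exact ⟨⟨heω, hne⟩, heW⟩
  intro i
  have hi : F i ∈ configOf squareLatticeEmbedding.z η Set.univ (insert s(a, v) ω ∩ W) := hin i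
  rw [mem_configOf_iff_exists_isCrossing_openEdgeUnion hη (Set.inter_subset_right.trans hW)] at hi
  show F i ∈ configOf squareLatticeEmbedding.z η Set.univ (ω \ {s(a, v)} ∩ W)
  rw [mem_configOf_iff_exists_isCrossing_openEdgeUnion hη (Set.inter_subset_right.trans hW)]
  obtain ⟨K, hK, hKO⟩ := hi
  have hcr : ∃ K, (F i).IsCrossing K ∧ K ⊆ openEdgeUnion dd (insert s(a, v) (ω ∩ W)) :=
    ⟨K, hK, hKO.trans (openEdgeUnion_mono dd h1)⟩
  obtain ⟨K', hK', hK'O⟩ := crossing_sdiff_pendant hdd (F i) hav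
    (fun y hy hyω => hv y hy hyω.1) hddr (fun j p hp => hz ▸ hfar i j p hp) hcr
  exact ⟨K', hK', hK'O.trans (openEdgeUnion_mono dd h2)⟩

/-! ## The `k = 2` bundle: a proper pattern crossing needs an open interior edge at the midpoint -/

/-- **Proper patterns of a far `k = 2` bundle need an open interior edge at the midpoint**
(registered helper of `stub_cornerLocalSlope`, the deterministic core of its penalty bound (A″₂)).  For
`k = 2` the bundle `B` of `(t, d)` consists of the sub-edges `{a, v}`, `{v, b}` with midpoint
`v = 2t + e_d` (canonical enumeration `bundle_param_canonical`); the two other lattice edges at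
`v` are the interior (non-axial) edges `edgeOf (v, d')` and `edgeOf (v - e_{d'}, d')`, `d' ≠ d`.
If the drawn `v` is at distance `≥ r ≥ 2η` from every quad side, `J ⊊ [2]`, and the pattern `J`
creates the localised crossing event on the rest of `ω` (`(ω ∖ B) ∪ J ∈ Aloc`, `ω ∖ B ∉ Aloc`),
then one of these two interior edges is open in `ω` — otherwise the single pattern edge is pendant
at `v`, and a pendant edge is never pivotal (`sdiff_mem_Aloc_of_pendant`). -/
theorem defect_two_subset_open : ∀ (k m : ℕ), k = 2 → ∀ (F : Fin m → Quad (Set.univ : Set ℂ)) (η r : ℝ), 0 < η → 2 * η ≤ r → ∀ (t : Site 2) (d d' : Fin 2), d' ≠ d → (∀ (i : Fin m) (j : Fin 4), ∀ p ∈ (F i).side j, r ≤ dist ((η : ℂ) * squareLatticeEmbedding.z (fun l => (k : ℤ) * t l + if l = d then 1 else 0)) p) → ∀ J ∈ (Finset.range k).powerset, J ≠ Finset.range k → {ω | ω \ edgeOf '' {vd : Site 2 × Fin 2 | ax k vd ∧ tb k vd = t ∧ vd.2 = d} ∪ ↑(J.image fun j : ℕ => edgeOf ((fun l => (k : ℤ)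 * t l + if l = d then (j : ℤ) else 0), d)) ∈ Aloc m F η} \ {ω | ω \ edgeOf '' {vd : Site 2 × Fin 2 | ax k vd ∧ tb k vd = t ∧ vd.2 = d} ∈ Aloc m F η} ⊆ {ω | edgeOf ((fun l => (k : ℤ) * t l + if l = d then 1 else 0), d') ∈ ω} ∪ {ω | edgeOf ((fun l => (k : ℤ) * t l + if l = d then 1 else 0) - dirVec d', d') ∈ ω} := by
  intro k m hk F η r hη hηr t d d' hd' hfar J hJ hJne
  subst hk
  obtain ⟨hw₁, -, -⟩ := bundle_param_canonical (k := 2) two_pos t d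
  set w : ℕ → Site 2 := fun j l => ((2 : ℕ) : ℤ) * t l + if l = d then (j : ℤ) else 0 with hw
  set v : Site 2 := fun l => ((2 : ℕ) : ℤ) * t l + if l = d then 1 else 0 with hv
  set Bset : Set (Sym2 (Site 2)) :=
    edgeOf '' {vd : Site 2 × Fin 2 | ax 2 vd ∧ tb 2 vd = t ∧ vd.2 = d} with hBset
  have hdv : ∀ i : Fin 2, (dirVec i : Site 2) = Pi.single i 1 := fun i => dirVec_eq_single i
  have hv1 : w 1 = v := by
    funext l
    simp only [hw, hv, Nat.cast_one]
  have hav : w 0 + dirVec d = v := by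
    funext l
    rw [Pi.add_apply, hdv, Pi.single_apply]
    simp only [hw, hv, Nat.cast_zero]
    split_ifs <;> ring
  -- the two sub-edges belong to the bundle
  have hmemB : ∀ j, j < 2 → edgeOf (w j, d) ∈ Bset := fun j hj =>
    ⟨(w j, d), ⟨(hw₁ j hj).1, (hw₁ j hj).2, rfl⟩, rfl⟩
  have he0 : s(w 0, v) ∈ Bset := by rw [← hav]; exact hmemB 0 (by norm_num)
  have he1 : s(v, v + dirVec d) ∈ Bset := by rw [← hv1]; exact hmemB 1 (by norm_num)
  -- the four lattice edges at the midpoint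
  have hmid : ∀ y, (zdGraph 2).Adj v y → s(v, y) ∈ Bset ∨ s(v, y) = edgeOf (v, d') ∨
      s(v, y) = edgeOf (v - dirVec d', d') := by
    intro y hy
    obtain ⟨i, h | h⟩ := (zdGraph_adj_iff v y).1 hy
    · rcases fin_two_cases_of_ne hd' i with hi | hi <;> rw [hi] at h
      · left
        rw [h, ← hdv]
        exact he1
      · right; left
        rw [h, ← hdv]
    · have hy' : y = v - Pi.single i 1 := by rw [h, add_sub_cancel_right]
      rcases fin_two_cases_of_ne hd' i with hi | hi <;> rw [hi] at hy'
      · left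
        have hya : y = w 0 := by rw [hy', ← hav, hdv, add_sub_cancel_right]
        rw [hya, Sym2.eq_swap]
        exact he0
      · right; right
        rw [hy', ← hdv, Sym2.eq_swap]
        show s(v - dirVec d', v) = s(v - dirVec d', v - dirVec d' + dirVec d')
        rw [sub_add_cancel]
  -- the proper patterns of `[2]`
  have hJsub : J ⊆ Finset.range 2 := Finset.mem_powerset.1 hJ
  have hlt : ∀ j ∈ J, j = 0 ∨ j = 1 := fun j hj => by
    have := Finset.mem_range.1 (hJsub hj)
    omega
  have hJcases : J = ∅ ∨ J = {0} ∨ J = {1} := by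
    by_cases h0 : (0 : ℕ) ∈ J <;> by_cases h1 : (1 : ℕ) ∈ J
    · exfalso
      refine hJne (Finset.Subset.antisymm hJsub fun j hj => ?_)
      have := Finset.mem_range.1 hj
      interval_cases j <;> assumption
    · right; left
      ext j
      constructor
      · intro hj
        rcases hlt j hj with rfl | rfl
        · simp
        · exact absurd hj h1
      · intro hj
        rw [Finset.mem_singleton.1 hj]
        exact h0
    · right; right
      ext j
      constructor
      · intro hj
        rcases hlt j hj with rfl | rfl
        · exact absurd hj h0
        · simp
      · intro hj
        rw [Finset.mem_singleton.1 hj]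
        exact h1
    · left
      ext j
      simp only [Finset.notMem_empty, iff_false]
      intro hj
      rcases hlt j hj with rfl | rfl
      exacts [h0 hj, h1 hj]
  rintro ω ⟨hin, hout⟩
  simp only [Set.mem_setOf_eq] at hin hout
  by_contra hcon
  simp only [Set.mem_union, Set.mem_setOf_eq, not_or] at hcon
  -- no open edge of `ω ∖ B` at the midpoint: every pattern edge at `v` is pendant
  have hpend : ∀ a y, (zdGraph 2).Adj v y → s(v, y) ∈ ω \ Bset → y = a := by
    intro a y hy hmem
    rcases hmid y hy with h | h | h
    · exact absurd h hmem.2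
    · exact absurd (h ▸ hmem.1) hcon.1
    · exact absurd (h ▸ hmem.1) hcon.2
  have hfar' : ∀ (i : Fin m) (j : Fin 4), ∀ p ∈ (F i).side j,
      r ≤ dist ((η : ℂ) * squareLatticeEmbedding.z v) p := hfar
  rcases hJcases with rfl | rfl | rfl
  · refine hout ?_
    simpa using hin
  · have hadj : (zdGraph 2).Adj (w 0) v := (zdGraph_adj_iff _ _).2 ⟨d, Or.inl (by rw [← hav, hdv])⟩
    have hin' : insert s(w 0, v) (ω \ Bset) ∈ Aloc m F η := by
      have himg : (↑(({0} : Finset ℕ).image fun j : ℕ => edgeOf (w j, d)) : Set (Sym2 (Site 2))) =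
          {s(w 0, v)} := by
        rw [Finset.image_singleton, Finset.coe_singleton, ← hav]
      rw [← Set.union_singleton, ← himg]
      exact hin
    have h := sdiff_mem_Aloc_of_pendant m F hη hηr hadj (hpend (w 0)) hfar' hin'
    rw [Set.sdiff_singleton_eq_self fun h' => h'.2 he0] at h
    exact hout h
  · have hadj : (zdGraph 2).Adj (v + dirVec d) v := (zdGraph_adj_iff _ _).2 ⟨d, Or.inr (by rw [hdv])⟩
    have hin' : insert s(v + dirVec d, v) (ω \ Bset) ∈ Aloc m F η := by
      have himg : (↑(({1} : Finset ℕ).image fun j : ℕ => edgeOf (w j, d)) : Set (Sym2 (Site 2))) =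
          {s(v + dirVec d, v)} := by
        rw [Finset.image_singleton, Finset.coe_singleton, hv1, Sym2.eq_swap]
      rw [← Set.union_singleton, ← himg]
      exact hin
    have h := sdiff_mem_Aloc_of_pendant m F hη hηr hadj (hpend (v + dirVec d)) hfar' hin'
    rw [Set.sdiff_singleton_eq_self fun h' => h'.2 (by rw [Sym2.eq_swap]; exact he1)] at h
    exact hout h

end Summit.CriticalPhenomena.CardyFormulaZ2.Theorems.CardySelfRefinement

end
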